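import Summits.ValiantsHypothesis.ValiantsHypothesis.Theorems.SymPencilHomogeneousDropTools

/-!
# Route `SymPencil` — second-order expansion of the adjugate along a line
# (tool file for the rung `sdc(per_4) ≥ 18`, `--supports` stmt-ValiantsHypothesis-5674)

For a square matrix `T` over a field, write `adj (1 + X T) = 𝔞₀ + 𝔞₁ X + 𝔞₂ X² + …` and
`det (1 + X T) = d₀ + d₁ X + d₂ X² + …` (`d₀ = 1`).  Comparing coefficients in
`adj (1 + X T) · (1 + X T) = det (1 + X T) · 1` gives

  `𝔞₀ = 1`, `𝔞₁ = d₁ · 1 - T`, `𝔞₂ = d₂ · 1 - d₁ · T + T²`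

(`map_coeff_adjugate_one_add`; no formula for `d₁, d₂` is needed downstream).  Consequently,
for `D` invertible and any `N`, the scalar polynomial `g(X) = bᵀ adj (D + X N) b'` has

  `g₀ = det D · bᵀ D⁻¹ b'`,
  `g₁ = det D · (d₁ bᵀ D⁻¹ b' - bᵀ D⁻¹ N D⁻¹ b')`,
  `g₂ = det D · (d₂ bᵀ D⁻¹ b' - d₁ bᵀ D⁻¹ N D⁻¹ b' + bᵀ D⁻¹ N D⁻¹ N D⁻¹ b')`

(`coeff_bilin_adjugate_line`).  These are the `t`-coefficients of the bordered determinant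
`det [[0, bᵀ],[b, tD + C]]` that carry the homogeneity information of a symmetric
determinantal representation at the origin (`SymPencilOriginMoments`).  The coefficient matrices
of a polynomial matrix `M` are written `M.map (fun p => p.coeff n)` (Mathlib's `matPolyEquiv`).
Elementary. [folklore]
-/

noncomputable section

-- single-conjunct layout: Sub = Summit, duplicated namespace component intended
set_option linter.dupNamespace false

namespace Summit.ValiantsHypothesis.ValiantsHypothesis.Theorems.SymPencilAdjugateExpansion

open Matrix Polynomial
open Summit.ValiantsHypothesis.ValiantsHypothesis.Theorems.SymPencilHomogeneousDropTools

universe u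

variable {k : Type u} [Field k] {ι : Type*} [Fintype ι] [DecidableEq ι]

/-- Coefficient matrices agree with the coefficients of `matPolyEquiv`. [folklore] -/
theorem matPolyEquiv_coeff (M : Matrix ι ι k[X]) (n : ℕ) :
    (matPolyEquiv M).coeff n = M.map (fun p : k[X] => p.coeff n) := by
  ext i j
  rw [matPolyEquiv_coeff_apply]
  rfl

/-- `matPolyEquiv (A + X • N) = C A + X * C N`. [folklore] -/
theorem matPolyEquiv_line (A N : Matrix ι ι k) :
    matPolyEquiv (A.map Polynomial.C + (Polynomial.X : k[X]) • N.map Polynomial.C) =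
      Polynomial.C A + Polynomial.X * Polynomial.C N := by
  ext n i j
  rw [matPolyEquiv_coeff_apply]
  change (Polynomial.C (A i j) + Polynomial.X * Polynomial.C (N i j)).coeff n =
    ((Polynomial.C A + Polynomial.X * Polynomial.C N).coeff n) i j
  rw [Polynomial.coeff_add, Polynomial.coeff_add, Matrix.add_apply]
  rcases n with _ | _ | n
  · simp
  · simp [Polynomial.coeff_C_succ]
  · simp [Polynomial.coeff_C_succ]

/-- `matPolyEquiv (1 + X • T) = C 1 + X * C T`. [folklore] -/
theorem matPolyEquiv_one_add (T : Matrix ι ι k) :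
    matPolyEquiv (1 + (Polynomial.X : k[X]) • T.map Polynomial.C) =
      Polynomial.C 1 + Polynomial.X * Polynomial.C T := by
  rw [← matPolyEquiv_line, Matrix.map_one Polynomial.C (map_zero _) (map_one _)]

/-- Coefficients of `P * (C A + X * C N)` in a polynomial ring with matrix coefficients:
constant term. [folklore] -/
theorem coeff_mul_CaddXC_zero (P : (Matrix ι ι k)[X]) (A N : Matrix ι ι k) :
    (P * (Polynomial.C A + Polynomial.X * Polynomial.C N)).coeff 0 = P.coeff 0 * A := by
  rw [mul_add, Polynomial.coeff_add, Polynomial.coeff_mul_C, ← mul_assoc, Polynomial.coeff_mul_C,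
    Polynomial.coeff_mul_X_zero, zero_mul, add_zero]

/-- Coefficients of `P * (C A + X * C N)`: the coefficient of `X ^ (n+1)`. [folklore] -/
theorem coeff_mul_CaddXC_succ (P : (Matrix ι ι k)[X]) (A N : Matrix ι ι k) (n : ℕ) :
    (P * (Polynomial.C A + Polynomial.X * Polynomial.C N)).coeff (n + 1) =
      P.coeff (n + 1) * A + P.coeff n * N := by
  rw [mul_add, Polynomial.coeff_add, Polynomial.coeff_mul_C, ← mul_assoc, Polynomial.coeff_mul_C,
    Polynomial.coeff_mul_X]

/-- The coefficient relations `𝔞₀ = d₀ • 1` and `𝔞ₙ₊₁ + 𝔞ₙ T = dₙ₊₁ • 1` for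
`adj (1 + X T) (1 + X T) = det (1 + X T) • 1`. [folklore] -/
theorem map_coeff_adjugate_one_add_rel (T : Matrix ι ι k) :
    (adjugate (1 + (Polynomial.X : k[X]) • T.map Polynomial.C)).map (fun p : k[X] => p.coeff 0) =
      (det (1 + (Polynomial.X : k[X]) • T.map Polynomial.C)).coeff 0 • (1 : Matrix ι ι k) ∧
    ∀ n, (adjugate (1 + (Polynomial.X : k[X]) • T.map Polynomial.C)).map
          (fun p : k[X] => p.coeff (n + 1)) +
        (adjugate (1 + (Polynomial.X : k[X]) • T.map Polynomial.C)).map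
          (fun p : k[X] => p.coeff n) * T =
      (det (1 + (Polynomial.X : k[X]) • T.map Polynomial.C)).coeff (n + 1) • (1 : Matrix ι ι k) := by
  set L : Matrix ι ι k[X] := 1 + (Polynomial.X : k[X]) • T.map Polynomial.C with hL
  have hmul : adjugate L * L = (det L) • 1 := Matrix.adjugate_mul _
  have hE := congr_arg matPolyEquiv hmul
  rw [map_mul, hL, matPolyEquiv_one_add, ← hL] at hE
  -- coefficients of the right-hand side
  have hR : ∀ n, (matPolyEquiv ((det L) • (1 : Matrix ι ι k[X]))).coeff n =
      (det L).coeff n • (1 : Matrix ι ι k) := by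
    intro n
    ext i j
    rw [matPolyEquiv_coeff_apply, Matrix.smul_apply, Matrix.smul_apply, Matrix.one_apply,
      Matrix.one_apply, smul_eq_mul, smul_eq_mul]
    split_ifs
    · rw [mul_one, mul_one]
    · rw [mul_zero, mul_zero, Polynomial.coeff_zero]
  refine ⟨?_, fun n => ?_⟩
  · have h : (matPolyEquiv (adjugate L) * (Polynomial.C 1 + Polynomial.X * Polynomial.C T)).coeff 0 =
        (matPolyEquiv ((det L) • (1 : Matrix ι ι k[X]))).coeff 0 := by
      rw [hE]
    rw [coeff_mul_CaddXC_zero, Matrix.mul_one, hR, matPolyEquiv_coeff] at h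
    exact h
  · have h : (matPolyEquiv (adjugate L) *
        (Polynomial.C 1 + Polynomial.X * Polynomial.C T)).coeff (n + 1) =
        (matPolyEquiv ((det L) • (1 : Matrix ι ι k[X]))).coeff (n + 1) := by
      rw [hE]
    rw [coeff_mul_CaddXC_succ, Matrix.mul_one, hR, matPolyEquiv_coeff, matPolyEquiv_coeff] at h
    exact h

/-- **Second-order expansion of `adj (1 + X T)`**: with `d = det (1 + X T)`,
`𝔞₀ = 1`, `𝔞₁ = d₁ • 1 - T`, `𝔞₂ = d₂ • 1 - d₁ • T + T * T`. [folklore] -/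
theorem map_coeff_adjugate_one_add (T : Matrix ι ι k) :
    (adjugate (1 + (Polynomial.X : k[X]) • T.map Polynomial.C)).map (fun p : k[X] => p.coeff 0) = 1 ∧
    (adjugate (1 + (Polynomial.X : k[X]) • T.map Polynomial.C)).map (fun p : k[X] => p.coeff 1) =
      (det (1 + (Polynomial.X : k[X]) • T.map Polynomial.C)).coeff 1 • (1 : Matrix ι ι k) - T ∧
    (adjugate (1 + (Polynomial.X : k[X]) • T.map Polynomial.C)).map (fun p : k[X] => p.coeff 2) =
      (det (1 + (Polynomial.X : k[X]) • T.map Polynomial.C)).coeff 2 • (1 : Matrix ι ι k) -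
        (det (1 + (Polynomial.X : k[X]) • T.map Polynomial.C)).coeff 1 • T + T * T := by
  obtain ⟨h0, hs⟩ := map_coeff_adjugate_one_add_rel T
  have hd0 : (det (1 + (Polynomial.X : k[X]) • T.map Polynomial.C)).coeff 0 = 1 := by
    have h := coeff_detLine_zero (1 : Matrix ι ι k) T
    rwa [Matrix.map_one Polynomial.C (map_zero _) (map_one _), Matrix.det_one] at h
  rw [hd0, one_smul] at h0
  have h1 := hs 0
  rw [h0, Matrix.one_mul] at h1
  have h1' := eq_sub_of_add_eq h1
  have h2 := hs 1
  rw [h1', Matrix.sub_mul, Matrix.smul_mul, Matrix.one_mul] at h2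
  refine ⟨h0, h1', ?_⟩
  rw [← h2]
  abel

/-! ### The bilinear form of the adjugate along a line through an invertible matrix -/

omit [DecidableEq ι] in
/-- Coefficients of `(C b) ⬝ M (C b')` are `b ⬝ Mₙ b'`. [folklore] -/
theorem coeff_cvec_dotProduct_mulVec (M : Matrix ι ι k[X]) (b b' : ι → k) (n : ℕ) :
    ((fun i => Polynomial.C (b i)) ⬝ᵥ M *ᵥ (fun i => Polynomial.C (b' i))).coeff n =
      b ⬝ᵥ M.map (fun p : k[X] => p.coeff n) *ᵥ b' := by
  simp only [dotProduct, Matrix.mulVec, Polynomial.finsetSum_coeff, Polynomial.coeff_C_mul,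
    Finset.mul_sum, Polynomial.coeff_mul_C, Matrix.map_apply]

/-- `adj (D + X N) = adj (1 + X D⁻¹N) * C (adj D)` for invertible `D`. [folklore] -/
theorem adjugate_line_eq {D : Matrix ι ι k} (hD : IsUnit D.det) (N : Matrix ι ι k) :
    adjugate (D.map Polynomial.C + (Polynomial.X : k[X]) • N.map Polynomial.C) =
      adjugate (1 + (Polynomial.X : k[X]) • (D⁻¹ * N).map Polynomial.C) *
        (adjugate D).map Polynomial.C := by
  have hfac : D.map Polynomial.C + (Polynomial.X : k[X]) • N.map Polynomial.C =
      D.map Polynomial.C * (1 + (Polynomial.X : k[X]) • (D⁻¹ * N).map Polynomial.C) := by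
    rw [Matrix.mul_add, Matrix.mul_one, Matrix.mul_smul, ← Matrix.map_mul, ← Matrix.mul_assoc,
      Matrix.mul_nonsing_inv _ hD, Matrix.one_mul]
  rw [hfac, Matrix.adjugate_mul_distrib]
  congr 1
  rw [← RingHom.mapMatrix_apply, ← RingHom.map_adjugate, RingHom.mapMatrix_apply]

omit [DecidableEq ι] in
/-- Coefficient matrices of `P * (C Q)` are `Pₙ * Q`. [folklore] -/
theorem map_coeff_mul_map_C (P : Matrix ι ι k[X]) (Q : Matrix ι ι k) (n : ℕ) :
    (P * Q.map Polynomial.C).map (fun p : k[X] => p.coeff n) =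
      P.map (fun p : k[X] => p.coeff n) * Q := by
  ext i j
  simp only [Matrix.map_apply, Matrix.mul_apply, Polynomial.finsetSum_coeff, Polynomial.coeff_mul_C]

/-- **The first three coefficients of `bᵀ adj (D + X N) b'`** for invertible `D`: there are scalars
`d₁, d₂` (the first two coefficients of `det (1 + X D⁻¹ N)`) with
`g₀ = det D · bᵀ D⁻¹ b'`, `g₁ = det D · (d₁ bᵀ D⁻¹ b' - bᵀ D⁻¹ N D⁻¹ b')`,
`g₂ = det D · (d₂ bᵀ D⁻¹ b' - d₁ bᵀ D⁻¹ N D⁻¹ b' + bᵀ D⁻¹ N D⁻¹ N D⁻¹ b')`. [folklore] -/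
theorem coeff_bilin_adjugate_line {D : Matrix ι ι k} (hD : IsUnit D.det) (N : Matrix ι ι k)
    (b b' : ι → k) : ∃ d₁ d₂ : k,
    ((fun i => Polynomial.C (b i)) ⬝ᵥ
        adjugate (D.map Polynomial.C + (Polynomial.X : k[X]) • N.map Polynomial.C) *ᵥ
        (fun i => Polynomial.C (b' i))).coeff 0 = D.det * (b ⬝ᵥ D⁻¹ *ᵥ b') ∧
    ((fun i => Polynomial.C (b i)) ⬝ᵥ
        adjugate (D.map Polynomial.C + (Polynomial.X : k[X]) • N.map Polynomial.C) *ᵥ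
        (fun i => Polynomial.C (b' i))).coeff 1 =
      D.det * (d₁ * (b ⬝ᵥ D⁻¹ *ᵥ b') - b ⬝ᵥ (D⁻¹ * N * D⁻¹) *ᵥ b') ∧
    ((fun i => Polynomial.C (b i)) ⬝ᵥ
        adjugate (D.map Polynomial.C + (Polynomial.X : k[X]) • N.map Polynomial.C) *ᵥ
        (fun i => Polynomial.C (b' i))).coeff 2 =
      D.det * (d₂ * (b ⬝ᵥ D⁻¹ *ᵥ b') - d₁ * (b ⬝ᵥ (D⁻¹ * N * D⁻¹) *ᵥ b') +
        b ⬝ᵥ (D⁻¹ * N * D⁻¹ * N * D⁻¹) *ᵥ b') := by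
  set T : Matrix ι ι k := D⁻¹ * N with hT
  obtain ⟨h0, h1, h2⟩ := map_coeff_adjugate_one_add T
  have hadj : adjugate D = D.det • D⁻¹ := by
    rw [Matrix.nonsing_inv_apply _ hD, smul_smul, IsUnit.mul_val_inv, one_smul]
  set d₁ : k := (det (1 + (Polynomial.X : k[X]) • T.map Polynomial.C)).coeff 1 with hd₁
  set d₂ : k := (det (1 + (Polynomial.X : k[X]) • T.map Polynomial.C)).coeff 2 with hd₂
  have hM1 : (d₁ • (1 : Matrix ι ι k) - T) * D⁻¹ = d₁ • D⁻¹ - D⁻¹ * N * D⁻¹ := by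
    rw [Matrix.sub_mul, Matrix.smul_mul, Matrix.one_mul, hT, Matrix.mul_assoc]
  have hM2 : (d₂ • (1 : Matrix ι ι k) - d₁ • T + T * T) * D⁻¹ =
      d₂ • D⁻¹ - d₁ • (D⁻¹ * N * D⁻¹) + D⁻¹ * N * D⁻¹ * N * D⁻¹ := by
    rw [Matrix.add_mul, Matrix.sub_mul, Matrix.smul_mul, Matrix.smul_mul, Matrix.one_mul, hT]
    simp only [Matrix.mul_assoc]
  refine ⟨d₁, d₂, ?_, ?_, ?_⟩
  all_goals
    rw [coeff_cvec_dotProduct_mulVec, adjugate_line_eq hD, map_coeff_mul_map_C, hadj,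
      Matrix.mul_smul, Matrix.smul_mulVec, dotProduct_smul, smul_eq_mul]
  · rw [h0, Matrix.one_mul]
  · rw [h1, hM1, Matrix.sub_mulVec, dotProduct_sub, Matrix.smul_mulVec, dotProduct_smul,
      smul_eq_mul]
  · rw [h2, hM2, Matrix.add_mulVec, Matrix.sub_mulVec, dotProduct_add, dotProduct_sub,
      Matrix.smul_mulVec, dotProduct_smul, smul_eq_mul, Matrix.smul_mulVec, dotProduct_smul,
      smul_eq_mul]

end Summit.ValiantsHypothesis.ValiantsHypothesis.Theorems.SymPencilAdjugateExpansion

end
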